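import Literature.Computability.Complexity.GraphEncodings
import Literature.Computability.Complexity.StackRoutines
import HarnessLib

/-!
# The framing of the Boolean encodings as flat strings: `boolPair`, `listBool`, `encodingFinVec`

Trunk `CplxCore`, toolkit next to `BoolEncodings.lean` / `GraphEncodings.lean`. Machines that
read or write the tree's self-delimiting codes (`boolPair x y`: every bit of `x` doubled, the
separator `01`, then `y`; `Encoding.listBool` / `encodingFinVec`: unary length header, then the
element codes, each framed by `boolPair`) need these codes as *flat concatenations*. This file
provides that view, in terms of `Com.repBits` (`StackRoutines.lean`; `repBits 2` is the doubling):

* `boolPair_eq : boolPair x y = repBits 2 x ++ [false, true] ++ y`;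
* `frames l` — the framed code of a list of codes (each doubled and closed by `01`), with
  `foldr_boolPair_eq` (the nested `boolPair` fold of `Encoding.listBool` is `frames`),
  `listBool_encode_eq`, `finVec_encode_eq`, and `boolUnpair_frames_cons` (reading a framed list
  entry by entry is iterated `boolUnpair`);
* `ccat g n` — concatenation of pieces `g 0 … g (n-1)` (the loop-friendly form of
  `List.ofFn`-indexed frames): `frames_ofFn`, `repBits_ccat`, `ccat_congr`;
* `sep a = 0^a 1^a` (the separator at doubling level `a`) and `repBits_frame`
  (`repBits a (repBits 2 c ++ 01) = repBits (2a) c ++ sep a`).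

First clients: `Cryptography/SISFunctionMachine.lean` (whose private copies of these lemmas this
file supersedes) and the GMSS oracle algorithm of `Algebra/EuclideanLattices/GapCVPPrime.lean`.

## References

* S. Arora, B. Barak, *Computational Complexity: A Modern Approach*, CUP 2009, §0.1
  (representations of pairs and tuples as strings).
-/

namespace Literature.Computability.Complexity

open _root_.Computability Com

/-- `boolPair` as doubling, separator, tail. [Arora–Barak 2009, §0.1] [folklore] -/
theorem boolPair_eq (x y : List Bool) : boolPair x y = repBits 2 x ++ [false, true] ++ y := by
  induction x with
  | nil => rfl
  | cons b x ih =>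
    simp only [boolPair, List.flatMap_cons, List.append_assoc] at ih ⊢
    simp [repBits]

/-- The framed code of a list of codes: each doubled and terminated by `01`. [folklore] -/
def frames (l : List (List Bool)) : List Bool :=
  (l.map fun c => repBits 2 c ++ [false, true]).flatten

/-- No frames. [folklore] -/
@[simp] theorem frames_nil : frames [] = [] := rfl

/-- One more frame. [folklore] -/
@[simp] theorem frames_cons (c : List Bool) (l : List (List Bool)) :
    frames (c :: l) = repBits 2 c ++ [false, true] ++ frames l := by
  simp [frames]

/-- `frames` is a monoid morphism. [folklore] -/
theorem frames_append (l l' : List (List Bool)) : frames (l ++ l') = frames l ++ frames l' := by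
  simp [frames]

/-- A framed cons is a `boolPair`. [folklore] -/
theorem frames_cons_eq_boolPair (c : List Bool) (l : List (List Bool)) :
    frames (c :: l) = boolPair c (frames l) := by
  rw [frames_cons, boolPair_eq]

/-- Reading a framed list entry by entry is iterated `boolUnpair`. [folklore] -/
@[simp] theorem boolUnpair_frames_cons (c : List Bool) (l : List (List Bool)) :
    boolUnpair (frames (c :: l)) = (c, frames l) := by
  rw [frames_cons_eq_boolPair, boolUnpair_boolPair]

/-- The nested `boolPair` fold of `Encoding.listBool` is the framed code. [folklore] -/
theorem foldr_boolPair_eq {α : Type} (f : α → List Bool) (l : List α) :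
    l.foldr (fun a acc => boolPair (f a) acc) [] = frames (l.map f) := by
  induction l with
  | nil => rfl
  | cons a l ih => rw [List.foldr_cons, ih, boolPair_eq, List.map_cons, frames_cons]

/-- Unfolding `Encoding.listBool`: unary length header, separator, framed element codes.
[Arora–Barak 2009, §0.1] [folklore] -/
theorem listBool_encode_eq {α : Type} (e : Encoding α Bool) (l : List α) :
    e.listBool.encode l =
      repBits 2 (unaryEncodeNat l.length) ++ [false, true] ++ frames (l.map e.encode) := by
  show boolPair _ (l.foldr _ []) = _
  rw [foldr_boolPair_eq, boolPair_eq]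

/-- Unfolding `encodingFinVec`. [Arora–Barak 2009, §0.1] [folklore] -/
theorem finVec_encode_eq {α : Type} (e : Encoding α Bool) (m : ℕ) (v : Fin m → α) :
    (encodingFinVec e m).encode v =
      repBits 2 (unaryEncodeNat m) ++ [false, true] ++ frames (List.ofFn fun i => e.encode (v i)) := by
  show e.listBool.encode (List.ofFn v) = _
  rw [listBool_encode_eq, List.length_ofFn, List.map_ofFn]
  rfl

/-! ### Concatenations of indexed pieces -/

/-- Concatenation of the pieces `g 0, …, g (n-1)`. [folklore] -/
def ccat (g : ℕ → List Bool) : ℕ → List Bool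
  | 0 => []
  | i + 1 => ccat g i ++ g i

/-- `ccat` of no pieces. [folklore] -/
@[simp] theorem ccat_zero (g : ℕ → List Bool) : ccat g 0 = [] := rfl

/-- One more piece. [folklore] -/
theorem ccat_succ (g : ℕ → List Bool) (n : ℕ) : ccat g (n + 1) = ccat g n ++ g n := rfl

/-- `ccat` depends only on the pieces below `n`. [folklore] -/
theorem ccat_congr {g g' : ℕ → List Bool} : ∀ {n : ℕ}, (∀ i, i < n → g i = g' i) → ccat g n = ccat g' n
  | 0, _ => rfl
  | n + 1, h => by rw [ccat, ccat, ccat_congr (fun i hi => h i (by omega)), h n (by omega)]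

/-- `repBits` of a concatenation of pieces. [folklore] -/
theorem repBits_ccat (a : ℕ) (g : ℕ → List Bool) : ∀ n, repBits a (ccat g n) = ccat (fun i => repBits a (g i)) n
  | 0 => rfl
  | n + 1 => by rw [ccat, repBits_append, repBits_ccat a g n, ccat]

/-- Length of a concatenation of pieces of bounded length. [folklore] -/
theorem length_ccat_le (g : ℕ → List Bool) (b : ℕ) (h : ∀ i, (g i).length ≤ b) : ∀ n, (ccat g n).length ≤ n * b
  | 0 => by simp
  | n + 1 => by rw [ccat, List.length_append, Nat.succ_mul]; exact Nat.add_le_add (length_ccat_le g b h n) (h n)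

/-- The framed code of `List.ofFn` is a `ccat`. [folklore] -/
theorem frames_ofFn (c : ℕ → List Bool) : ∀ n : ℕ,
    frames (List.ofFn fun i : Fin n => c i) = ccat (fun i => repBits 2 (c i) ++ [false, true]) n
  | 0 => rfl
  | n + 1 => by
    rw [List.ofFn_succ', List.concat_eq_append, frames_append, ccat, ← frames_ofFn c n]
    simp [frames]

/-! ### Separators at higher doubling levels -/

/-- The separator `0^a 1^a` (the `01` of `boolPair` at doubling level `a`). [folklore] -/
def sep (a : ℕ) : List Bool := List.replicate a false ++ List.replicate a true

/-- Length of a separator. [folklore] -/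
@[simp] theorem length_sep (a : ℕ) : (sep a).length = a + a := by simp [sep]

/-- The separator is the repeated `01`. [folklore] -/
theorem sep_eq (a : ℕ) : sep a = repBits a [false, true] := by simp [sep, repBits]

/-- The repeated `01` is the separator. [folklore] -/
theorem repBits_false_true (a : ℕ) : repBits a [false, true] = sep a := (sep_eq a).symm

/-- Repeating a frame: the payload doubles its level, the `01` becomes a separator. [folklore] -/
theorem repBits_frame (a : ℕ) (c : List Bool) : repBits a (repBits 2 c ++ [false, true]) = repBits (2 * a) c ++ sep a := by
  rw [repBits_append, repBits_repBits, sep_eq]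

end Literature.Computability.Complexity
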